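import Summits.QuantumFields.YangMills.Theorems.BalabanUVNodesN11AllStepsQuadSlot

/-!
# DAG node N11 — THE `ζ0`-VALUE DIAL AT EVERY STEP: with `quad` LEFT UNTOUCHED, the VALUE of the top-generation residual factor `ζ_k(Ω_{k+1}ᶜ)` (free in `[0,1]` under the rows) reads `V_{k+1}`
# only, passes through the newest generation of `𝐓_{k+1}(s)`, and with `v := (𝐓ρ_k)(s) ∕ J_p(s)` serves every child — so a pin of `quad` ALONE does not remove the fiat at any step; next to
# every `θ` and inside K1⁹'s hypothesis class, every 𝐓-law follows from support conditions + term laws, the rows costing one range inequality (count-neutral, LOCATED; nothing of Bałaban)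

HEADER — WORK-UNIT METADATA.  Cell `pub-ymgap`, YM-PLAN Track A (HUMAN RULING D-0062), seat `pub-ymgap-dag-n11-d` (g34; N11 [B14], s2), route `BalabanUVNodes`, item K1⁹ =
stmt-QuantumFields-27364 (helper lane, `--kind proof --supports 27364 --as helper`, count-neutral).  [III] = [Balaban1988Convergent].  Over this seat's `…N11AllStepsQuadSlot` (g34: ★★
`sect2Slot_succ_mul` — multipliers at the top generation pass through `𝐓_{k+1}(s)`; the `quad`-dial edition), `…N11TopPairZetaValueDial` (g34: the top pair), `…TopPairQuadSlot` ∕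
`…K1Hypotheses` (`slotsTOfRecord_nonneg_of_provisos₁₃CoPH`, the `sameR` transports), RECORD 13 v1.7∕v1.8 `H`; RR-2 g21's folded type-owner sentence (bus 2026-08-29T15:35:31Z).

WHY ∕ WHAT.  The companion `…AllStepsQuadSlot` dials `quad`; `…TopPairZetaValueDial` shows that at the top pair the VALUE of `ζ0` is an independent dial.  Here the value dial at EVERY
step: §1 ★★★ `slotsT_succ_eq_sect2Slot_of_value` (weight data with `θ`'s A-weights at every generation, `θ`'s `ζ`-factors below generation `k`, and top-generation factor on `Ω_{k+1}ᶜ`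
equal to a value `v(V_{k+1})` with `v·J = T` pointwise ⇒ old side `=` new side; `J` = `θ`'s own new side with the top-generation factor set to `1`, `T = (𝐓ρ_k)(s)`).  §2 the value re-pin
(`v` on `Ω_nᶜ`, `1 − v` on a spare region, at the top generation of every history length; `quad` and everything below unchanged) next to every `θ`: ★ `zhLocal_of_valueRepinTop` · ★
`zhUnity_of_valueRepinTop` (outright) · ★ `zhLaws_of_valueRepinTop` (⟸ `0 ≤ v ≤ 1`) · ★★★★★ `exists_zh_allSteps_tLaw_by_value_of_supports` (`v = T ∕ J`; for every run and EVERY `k`: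
(i) `0 ≤ 𝐓ρ_k` ∧ (ii) per child a.e. on the `χ_{k+1}(s)`-support «`0 < (𝐓ρ_k)(s) → 0 < J_p(s)`» ∧ (iii) `Sect2.LawsT … k` ⟹ `TLaw₁₃CoPH θ′ p k`; `zhLaws` under the range inequality, which
the free constants `E_k` of (2.23) buy wherever `T ∕ J` is bounded) · ★★★★★ `…_of_hypotheses` (inside K1⁹'s hypothesis class).  READING (director's column, with RR-2's folded sentence):
`quad`'s pin (C2) and `ζ0`'s VALUE pin (K0b) are BOTH needed before any 𝐓-law conjunct of K1⁹ carries quantitative content; either alone leaves a dial.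

HONEST FRAMING.  A READING on the tree's own rows and objects (count-neutral, LOCATED): nothing of Bałaban asserted or refuted; the value profile is NOT print's `ζ`; (ii), (iii) and the
range inequality are NOT claimed at any `θ`; K1⁹'s `∃θ` NOT advanced and NOT refuted (𝐒-laws, 𝐑-steps, consequent faces untouched); no `Stage13HParams` of record constructed or modified;
N11 NOT discharged; K1⁹ NOT closed; no registered stub touched; counts unmoved (typed 28∕28 · discharged 8∕27).  One finite four-torus programme at fixed `ε = L^{−K}`; NOT ℝ⁴, NOT OS, NOT a
mass gap, NOT Clay.  No `sorry`, `axiom`, `def`, `instance`, `notation`.  Sources (SHAPE only): [III] Thm 1 p.262, remark p.262, (2.18) p.257, (2.20)–(2.23) p.258, (3.2)–(3.9) pp.265–266,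
p.267, (3.16)–(3.21) pp.268–269, (3.23)–(3.25) p.270, Def. p.279.
-/

noncomputable section

open MeasureTheory
open scoped BigOperators Matrix.Norms.L2Operator

namespace Summit.QuantumFields.YangMills.Theorems.BalabanUVNodesN11AllStepsZetaValueDial

open Literature.MathematicalPhysics.QuantumFieldTheory.Balaban1983to89 T4Continuum Node00 Node00.Tk B14.Eq218Concrete B14.Sect3Decomp
open BalabanUVNodesN11TopPairLocalResidual (WtOfRecord₁₃H_ζ_eq_ζ0)
open BalabanUVNodesN11TopPairQuadSlot (slotsTOfRecord_nonneg_of_provisos₁₃CoPH)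
open BalabanUVNodesN11TopPairQuadSlotK1Hypotheses (provisos₁₃SepCoPH_of_sameR slotsNondegenerate₁₃_of_sameR admissible_of_sameR)
open BalabanUVNodesN11AllStepsQuadSlot (sect2Slot_succ_mul)

variable {F : T4Family} {N : ℕ} [NeZero N]

/-! ## §1. At the record, step `k → k+1`, child `s`: a VALUE `v(V_{k+1})` of the generation-`k` residual factor on `Ω_{k+1}ᶜ` multiplies the reference new side; `v·J = T` serves the child -/

section Record

variable (θ : Stage13HParams F N) (p : B12.RunParams)

/-- ★★★ **THE VALUE DIAL AT AN ARBITRARY CHILD OF AN ARBITRARY STEP, `quad` UNTOUCHED** (any terms; `T` = the old side `(𝐓ρ_k)(s)`, `J` = `θ`'s own new side at `s` with the generation-`k`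
residual factor set to `1`): weight data `W′` with `θ`'s A-weights at EVERY generation, `θ`'s `ζ`-factors below generation `k`, and generation-`k` `ζ`-factor on `Ω_{k+1}ᶜ` equal to a VALUE
`v(V_{k+1})` with `v·J = T` pointwise give OLD SIDE = NEW SIDE at every `V`. [cite: Balaban1988Convergent, (2.18) p.257, (2.21)–(2.23) p.258, (3.23)–(3.25) p.270 (bookkeeping)] -/
theorem slotsT_succ_eq_sect2Slot_of_value {k : ℕ} (s : SeqOfRecord F θ.ν θ.τ9.M (gOfRecord₁₃ F N θ.toStage13Params p) p.K (k + 1))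
    (u₁ : Sect2.TermValues (F.P p.K) (MatA N) (FluctV N) θ.τ9.M) (e₁ : ℝ) (W' : TkWeights F N (FluctV N) p.K) (v : GaugeField (F.P p.K) (k + 1) (SU N) → ℝ)
    (hζlt : ∀ j, j < k → W'.ζ j (s.Ω (j + 1))ᶜ = (WtOfRecord₁₃H F N θ p s).ζ j (s.Ω (j + 1))ᶜ)
    (hw : ∀ j S₁, W'.w j (s.Λ (j + 1)) ((s.Λ (j + 1))ᶜ ∩ s.Ω (j + 1)) S₁ = (WtOfRecord₁₃H F N θ p s).w j (s.Λ (j + 1)) ((s.Λ (j + 1))ᶜ ∩ s.Ω (j + 1)) S₁)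
    (hζ : ∀ ω, W'.ζ k (s.Ω (k + 1))ᶜ ω = v (ω (k + 1)).1) (V : GaugeField (F.P p.K) (k + 1) (SU N))
    (hval : v V * sect2Slot F N (FluctV N) p.K (settingOfRecord₁₃ F N θ.toStage13Params p) (θ.rzAt p s)
        { WtOfRecord₁₃H F N θ p s with ζ := fun j Y ω => if j = k then 1 else (WtOfRecord₁₃H F N θ p s).ζ j Y ω } s u₁ e₁ (UbgOfRecord₁₃CoP F N θ.toStage13Params p (k + 1) s) V =
      slotsTOfRecord F N θ.ν θ.τ9 (EOfRecord₁₃ F N θ.toStage13Params) (wOfRecord₉ F N θ.toStage9Params) θ.ppSel p (gOfRecord₁₃ F N θ.toStage13Params p) (k + 1) s V) :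
    slotsTOfRecord F N θ.ν θ.τ9 (EOfRecord₁₃ F N θ.toStage13Params) (wOfRecord₉ F N θ.toStage9Params) θ.ppSel p (gOfRecord₁₃ F N θ.toStage13Params p) (k + 1) s V =
      sect2Slot F N (FluctV N) p.K (settingOfRecord₁₃ F N θ.toStage13Params p) (θ.rzAt p s) W' s u₁ e₁ (UbgOfRecord₁₃CoP F N θ.toStage13Params p (k + 1) s) V := by
  rw [sect2Slot_succ_mul θ.ν θ.τ9.M (gOfRecord₁₃ F N θ.toStage13Params p) p.K s
    (W := { WtOfRecord₁₃H F N θ p s with ζ := fun j Y ω => if j = k then 1 else (WtOfRecord₁₃H F N θ p s).ζ j Y ω }) (W' := W') v (fun _ => 1)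
    (fun j hj => by rw [hζlt j hj]; exact (funext fun ω => if_neg (Nat.ne_of_lt hj)).symm) (fun j hj S₁ => hw j S₁)
    (fun ω => by rw [hζ]; exact (mul_one _).symm.trans (congrArg _ (if_pos rfl).symm)) (fun S₁ ω => by rw [hw k S₁, one_mul]; rfl)
    (settingOfRecord₁₃ F N θ.toStage13Params p) (θ.rzAt p s) u₁ e₁ (UbgOfRecord₁₃CoP F N θ.toStage13Params p (k + 1) s) V, mul_one, hval]

end Record

/-! ## §2. Next to every `θ`, `quad` UNTOUCHED: the value re-pin at the top generation of every history length; `zhLocal` ∕ `ZhUnity` outright, `zhLaws` under the range inequality -/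

section Inhabited

variable {θ θ' : Stage13HParams F N}
  {v : (p : B12.RunParams) → (n : ℕ) → (ℕ → Set (Site (F.P p.K) 0)) → (ℕ → Set (Site (F.P p.K) 0)) → GaugeField (F.P p.K) n (SU N) → ℝ}

/-- ★ The row `zhLocal` transfers to the value re-pin (the new top-generation factor reads `(ω n).1` only). [cite: Balaban1988Convergent, (3.1) p.264, (3.2)–(3.4) p.265, p.267] -/
theorem zhLocal_of_valueRepinTop
    (hζ' : ∀ p n Ω Λ j Y ω, (θ'.Zh p n Ω Λ).ζ0 j Y ω = if j + 1 = n then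
      Set.indicator {(Ω n)ᶜ} (fun _ => v p n Ω Λ (ω n).1) Y + Set.indicator {if (Ω n)ᶜ = (∅ : Set (Site (F.P p.K) 0)) then Set.univ else ∅} (fun _ => 1 - v p n Ω Λ (ω n).1) Y
      else (θ.Zh p n Ω Λ).ζ0 j Y ω)
    (hloc : ∀ p n Ω Λ, (θ.Zh p n Ω Λ).LocalLaws) : ∀ p n Ω Λ, (θ'.Zh p n Ω Λ).LocalLaws := by
  intro p n Ω Λ
  refine ⟨fun j Y ω ω' hj hj1 => ?_⟩
  rw [hζ', hζ']
  by_cases h : j + 1 = n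
  · subst h
    rw [if_pos rfl, if_pos rfl, hj1]
  · rw [if_neg h, if_neg h]
    exact (hloc p n Ω Λ).zeta0_local j Y ω ω' hj hj1

/-- ★ The guard `ZhUnity` transfers to the value re-pin UNCONDITIONALLY (`v + (1 − v) = 1`; the spare region differs from `Ω_nᶜ`). [cite: Balaban1988Convergent, (3.16)–(3.20) pp.268–269] -/
theorem zhUnity_of_valueRepinTop
    (hζ' : ∀ p n Ω Λ j Y ω, (θ'.Zh p n Ω Λ).ζ0 j Y ω = if j + 1 = n then
      Set.indicator {(Ω n)ᶜ} (fun _ => v p n Ω Λ (ω n).1) Y + Set.indicator {if (Ω n)ᶜ = (∅ : Set (Site (F.P p.K) 0)) then Set.univ else ∅} (fun _ => 1 - v p n Ω Λ (ω n).1) Y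
      else (θ.Zh p n Ω Λ).ζ0 j Y ω)
    (hU : θ.ZhUnity) : θ'.ZhUnity := by
  intro p n Ω Λ j ω
  simp_rw [hζ']
  by_cases h : j + 1 = n
  · simp_rw [if_pos h]
    rw [finsum_add_distrib (Set.toFinite _) (Set.toFinite _),
      finsum_eq_single _ ((Ω n)ᶜ) (fun Y hY => Set.indicator_of_notMem (by simpa using hY) _),
      finsum_eq_single _ (if (Ω n)ᶜ = (∅ : Set (Site (F.P p.K) 0)) then Set.univ else ∅) (fun Y hY => Set.indicator_of_notMem (by simpa using hY) _),
      Set.indicator_of_mem (Set.mem_singleton _), Set.indicator_of_mem (Set.mem_singleton _)]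
    ring
  · simp_rw [if_neg h]
    exact hU p n Ω Λ j ω

/-- ★ The row `zhLaws` (`ζ0 ≥ 0`) transfers to the value re-pin UNDER THE RANGE INEQUALITY `0 ≤ v ≤ 1`. [cite: Balaban1988Convergent, p.267 (bookkeeping)] -/
theorem zhLaws_of_valueRepinTop
    (hζ' : ∀ p n Ω Λ j Y ω, (θ'.Zh p n Ω Λ).ζ0 j Y ω = if j + 1 = n then
      Set.indicator {(Ω n)ᶜ} (fun _ => v p n Ω Λ (ω n).1) Y + Set.indicator {if (Ω n)ᶜ = (∅ : Set (Site (F.P p.K) 0)) then Set.univ else ∅} (fun _ => 1 - v p n Ω Λ (ω n).1) Y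
      else (θ.Zh p n Ω Λ).ζ0 j Y ω)
    (hv : ∀ p n Ω Λ V, 0 ≤ v p n Ω Λ V ∧ v p n Ω Λ V ≤ 1) (hlaws : ∀ p n Ω Λ, (θ.Zh p n Ω Λ).Laws) : ∀ p n Ω Λ, (θ'.Zh p n Ω Λ).Laws := by
  intro p n Ω Λ
  refine ⟨fun j Y ω => ?_⟩
  rw [hζ']
  by_cases h : j + 1 = n
  · rw [if_pos h]
    exact add_nonneg (Set.indicator_nonneg (fun _ _ => (hv p n Ω Λ _).1) Y) (Set.indicator_nonneg (fun _ _ => sub_nonneg.2 (hv p n Ω Λ _).2) Y)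
  · rw [if_neg h]
    exact (hlaws p n Ω Λ).zeta0_nonneg j Y ω

/-- ★★★★★ **HEADLINE — WITH `quad` UNTOUCHED, THE VALUE OF THE TOP-GENERATION RESIDUAL FACTOR SERVES EVERY 𝐓-LAW MODULO SUPPORTS; THE ROWS COST ONE RANGE INEQUALITY.**  Next to every
`θ`, for any prescribed terms `(u_p, e_p)`: a value family `v` and a parameter `θ′` with the SAME `Stage13RParams` data, `Phih` AND `quad` (every generation, every history), residual
factors agreeing with `θ`'s below the top generation of each history length, the top-generation factor being the VALUE `v_{p,n,Ω,Λ}(V_n) = (𝐓ρ_{n−1})(s)(V_n) ∕ J_p(s)(V_n)` on `Ω_nᶜ` and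
`1 − v` on a spare region (`J_p(s)` = `θ`'s own new side with the top-generation factor set to `1`; `x ∕ 0 = 0`), such that: `zhLocal` and `ZhUnity` transfer outright; `zhLaws` transfers
under the range inequality `0 ≤ v ≤ 1` (i.e. `0 ≤ 𝐓ρ_k(s) ≤ J_p(s)` wherever `J_p(s) > 0` — the free constants `E_k` of (2.23) scale `J_p` by `e^{−E_k}`); and for every run `p` and EVERY step
`k`: (i) `0 ≤ 𝐓ρ_k` ∧ (ii) per child a.e. on the `χ_{k+1}(s)`-support «`0 < (𝐓ρ_k)(s) → 0 < J_p(s)`» ∧ (iii) `Sect2.LawsT … k` ⟹ `TLaw₁₃CoPH θ′ p k`.  So pinning `quad` (C2) does NOT remove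
the fiat at any step: the VALUES of `ζ0` must be pinned as well (K0b).  LOCATED, count-neutral; nothing of Bałaban asserted or refuted; (ii), the range inequality and (iii) are NOT
claimed at any `θ`; K1⁹'s `∃θ` neither advanced nor refuted. [cite: Balaban1988Convergent, Thm 1 p.262, remark p.262, (2.18) p.257, (2.21)–(2.23) p.258, (3.2) p.265, p.267, (3.16)–(3.21) pp.268–269, (3.23)–(3.25) p.270, Def. p.279] -/
theorem exists_zh_allSteps_tLaw_by_value_of_supports (θ : Stage13HParams F N)
    (u : (p : B12.RunParams) → (M : ℕ) → Sect2.TermValues (F.P p.K) (MatA N) (FluctV N) M) (e : B12.RunParams → ℝ) :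
    ∃ (v : (p : B12.RunParams) → (n : ℕ) → (ℕ → Set (Site (F.P p.K) 0)) → (ℕ → Set (Site (F.P p.K) 0)) → GaugeField (F.P p.K) n (SU N) → ℝ) (θ' : Stage13HParams F N),
      θ'.toStage13RParams = θ.toStage13RParams ∧ θ'.Phih = θ.Phih ∧
      (∀ p n Ω Λ j Y ω, j + 1 ≠ n → (θ'.Zh p n Ω Λ).ζ0 j Y ω = (θ.Zh p n Ω Λ).ζ0 j Y ω) ∧
      (∀ p n Ω Λ j Λ' ω, (θ'.Zh p n Ω Λ).quad j Λ' ω = (θ.Zh p n Ω Λ).quad j Λ' ω) ∧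
      ((∀ p n Ω Λ, (θ.Zh p n Ω Λ).LocalLaws) → ∀ p n Ω Λ, (θ'.Zh p n Ω Λ).LocalLaws) ∧
      (θ.ZhUnity → θ'.ZhUnity) ∧
      ((∀ p n Ω Λ V, 0 ≤ v p n Ω Λ V ∧ v p n Ω Λ V ≤ 1) → (∀ p n Ω Λ, (θ.Zh p n Ω Λ).Laws) → ∀ p n Ω Λ, (θ'.Zh p n Ω Λ).Laws) ∧
      (∀ (p : B12.RunParams) (k : ℕ) (s : SeqOfRecord F θ.ν θ.τ9.M (gOfRecord₁₃ F N θ.toStage13Params p) p.K (k + 1)) (V : GaugeField (F.P p.K) (k + 1) (SU N)),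
        v p (k + 1) s.Ω s.Λ V =
          slotsTOfRecord F N θ.ν θ.τ9 (EOfRecord₁₃ F N θ.toStage13Params) (wOfRecord₉ F N θ.toStage9Params) θ.ppSel p (gOfRecord₁₃ F N θ.toStage13Params p) (k + 1) s V /
            sect2Slot F N (FluctV N) p.K (settingOfRecord₁₃ F N θ.toStage13Params p) (θ.rzAt p s)
              { WtOfRecord₁₃H F N θ p s with ζ := fun j Y ω => if j = k then 1 else (WtOfRecord₁₃H F N θ p s).ζ j Y ω } s (u p θ.τ9.M) (e p)
              (UbgOfRecord₁₃CoP F N θ.toStage13Params p (k + 1) s) V) ∧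
      ∀ (p : B12.RunParams) (k : ℕ),
        (∀ (s : SeqOfRecord F θ.ν θ.τ9.M (gOfRecord₁₃ F N θ.toStage13Params p) p.K (k + 1)) (V : GaugeField (F.P p.K) (k + 1) (SU N)),
          0 ≤ slotsTOfRecord F N θ.ν θ.τ9 (EOfRecord₁₃ F N θ.toStage13Params) (wOfRecord₉ F N θ.toStage9Params) θ.ppSel p (gOfRecord₁₃ F N θ.toStage13Params p) (k + 1) s V) →
        (∀ s : SeqOfRecord F θ.ν θ.τ9.M (gOfRecord₁₃ F N θ.toStage13Params p) p.K (k + 1),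
          ∀ᵐ V ∂fieldMeasure (F.P p.K) (k + 1) (SU N), chiSeqOfRecord F N θ.ν θ.τ9.M (gOfRecord₁₃ F N θ.toStage13Params p) p.K (k + 1) s V ≠ 0 →
            0 < slotsTOfRecord F N θ.ν θ.τ9 (EOfRecord₁₃ F N θ.toStage13Params) (wOfRecord₉ F N θ.toStage9Params) θ.ppSel p (gOfRecord₁₃ F N θ.toStage13Params p) (k + 1) s V →
            0 < sect2Slot F N (FluctV N) p.K (settingOfRecord₁₃ F N θ.toStage13Params p) (θ.rzAt p s)
              { WtOfRecord₁₃H F N θ p s with ζ := fun j Y ω => if j = k then 1 else (WtOfRecord₁₃H F N θ p s).ζ j Y ω } s (u p θ.τ9.M) (e p)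
              (UbgOfRecord₁₃CoP F N θ.toStage13Params p (k + 1) s) V) →
        (∀ s : SeqOfRecord F θ.ν θ.τ9.M (gOfRecord₁₃ F N θ.toStage13Params p) p.K (k + 1),
          Sect2.LawsT (sect2TowerOfRecord F N (FluctV N) p.K (settingOfRecord₁₃ F N θ.toStage13Params p) (θ.rzAt p s) s (u p θ.τ9.M))
            (settingOfRecord₁₃ F N θ.toStage13Params p).lf (settingOfRecord₁₃ F N θ.toStage13Params p).βc k) →
        TLaw₁₃CoPH F N θ' p k := by
  classical
  let T : (p : B12.RunParams) → (k : ℕ) → SeqOfRecord F θ.ν θ.τ9.M (gOfRecord₁₃ F N θ.toStage13Params p) p.K (k + 1) → GaugeField (F.P p.K) (k + 1) (SU N) → ℝ :=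
    fun p k s V => slotsTOfRecord F N θ.ν θ.τ9 (EOfRecord₁₃ F N θ.toStage13Params) (wOfRecord₉ F N θ.toStage9Params) θ.ppSel p (gOfRecord₁₃ F N θ.toStage13Params p) (k + 1) s V
  let J : (p : B12.RunParams) → (k : ℕ) → SeqOfRecord F θ.ν θ.τ9.M (gOfRecord₁₃ F N θ.toStage13Params p) p.K (k + 1) → GaugeField (F.P p.K) (k + 1) (SU N) → ℝ :=
    fun p k s V => sect2Slot F N (FluctV N) p.K (settingOfRecord₁₃ F N θ.toStage13Params p) (θ.rzAt p s)
      { WtOfRecord₁₃H F N θ p s with ζ := fun j Y ω => if j = k then 1 else (WtOfRecord₁₃H F N θ p s).ζ j Y ω } s (u p θ.τ9.M) (e p)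
      (UbgOfRecord₁₃CoP F N θ.toStage13Params p (k + 1) s) V
  -- the value per run, history length `n = k+1` and history `(Ω, Λ)` (nothing at length `0`)
  let v : (p : B12.RunParams) → (n : ℕ) → (ℕ → Set (Site (F.P p.K) 0)) → (ℕ → Set (Site (F.P p.K) 0)) → GaugeField (F.P p.K) n (SU N) → ℝ := fun p n Ω Λ =>
    match n with
    | 0 => fun _ => 0
    | k + 1 => fun V => if h : ∃ s : SeqOfRecord F θ.ν θ.τ9.M (gOfRecord₁₃ F N θ.toStage13Params p) p.K (k + 1), s.Ω = Ω ∧ s.Λ = Λ then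
        T p k h.choose V / J p k h.choose V else 0
  let Zh' : (p : B12.RunParams) → ℕ → (ℕ → Set (Site (F.P p.K) 0)) → (ℕ → Set (Site (F.P p.K) 0)) → TkResidualW F N (FluctV N) p.K := fun p n Ω Λ =>
    ⟨fun j Y ω => if j + 1 = n then
        Set.indicator {(Ω n)ᶜ} (fun _ => v p n Ω Λ (ω n).1) Y + Set.indicator {if (Ω n)ᶜ = (∅ : Set (Site (F.P p.K) 0)) then Set.univ else ∅} (fun _ => 1 - v p n Ω Λ (ω n).1) Y
      else (θ.Zh p n Ω Λ).ζ0 j Y ω,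
      (θ.Zh p n Ω Λ).quad⟩
  let θ' : Stage13HParams F N := { θ with Zh := Zh' }
  have hζ' : ∀ p n Ω Λ j Y ω, (θ'.Zh p n Ω Λ).ζ0 j Y ω = if j + 1 = n then
      Set.indicator {(Ω n)ᶜ} (fun _ => v p n Ω Λ (ω n).1) Y + Set.indicator {if (Ω n)ᶜ = (∅ : Set (Site (F.P p.K) 0)) then Set.univ else ∅} (fun _ => 1 - v p n Ω Λ (ω n).1) Y
      else (θ.Zh p n Ω Λ).ζ0 j Y ω := fun _ _ _ _ _ _ _ => rfl
  have hQ : ∀ p n Ω Λ j Λ' ω, (θ'.Zh p n Ω Λ).quad j Λ' ω = (θ.Zh p n Ω Λ).quad j Λ' ω := fun _ _ _ _ _ _ _ => rfl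
  have hYo : ∀ (p : B12.RunParams) (n : ℕ) (Ω : ℕ → Set (Site (F.P p.K) 0)), (Ω n)ᶜ ∉ ({if (Ω n)ᶜ = (∅ : Set (Site (F.P p.K) 0)) then Set.univ else ∅} : Set (Set (Site (F.P p.K) 0))) :=
    fun p n Ω h => by
    have h' := Set.mem_singleton_iff.1 h
    by_cases he : (Ω n)ᶜ = (∅ : Set (Site (F.P p.K) 0))
    · rw [if_pos he] at h'; exact Set.empty_ne_univ (he.symm.trans h')
    · rw [if_neg he] at h'; exact he h'
  have hvs : ∀ (p : B12.RunParams) (k : ℕ) (s : SeqOfRecord F θ.ν θ.τ9.M (gOfRecord₁₃ F N θ.toStage13Params p) p.K (k + 1)) V, v p (k + 1) s.Ω s.Λ V = T p k s V / J p k s V := by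
    intro p k s V
    have hex : ∃ s₀ : SeqOfRecord F θ.ν θ.τ9.M (gOfRecord₁₃ F N θ.toStage13Params p) p.K (k + 1), s₀.Ω = s.Ω ∧ s₀.Λ = s.Λ := ⟨s, rfl, rfl⟩
    have hch : hex.choose = s := Seq.ext' hex.choose_spec.1 hex.choose_spec.2
    show (if h : ∃ s₀ : SeqOfRecord F θ.ν θ.τ9.M (gOfRecord₁₃ F N θ.toStage13Params p) p.K (k + 1), s₀.Ω = s.Ω ∧ s₀.Λ = s.Λ then T p k h.choose V / J p k h.choose V else 0) = _
    rw [dif_pos hex, hch]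
  refine ⟨v, θ', rfl, rfl, fun p n Ω Λ j Y ω hj => by rw [hζ', if_neg hj], hQ, zhLocal_of_valueRepinTop hζ', zhUnity_of_valueRepinTop hζ',
    fun hv => zhLaws_of_valueRepinTop hζ' hv, hvs, fun p k hT0 hJ hlaw => ?_⟩
  refine (tLaw₁₃CoPH_iff F N θ' p k).2 ⟨fun _ => u p θ.τ9.M, fun _ => e p, Sect2.universalE_const _, fun s => ⟨hlaw s, Or.inr ?_⟩⟩
  have hne : ∀ j, j < k → j + 1 ≠ k + 1 := fun j hj h => (Nat.ne_of_lt hj) (Nat.succ_injective h)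
  have hζlt : ∀ j, j < k → (WtOfRecord₁₃H F N θ' p s).ζ j (s.Ω (j + 1))ᶜ = (WtOfRecord₁₃H F N θ p s).ζ j (s.Ω (j + 1))ᶜ := fun j hj => by
    funext ω
    rw [WtOfRecord₁₃H_ζ_eq_ζ0, WtOfRecord₁₃H_ζ_eq_ζ0, hζ', if_neg (hne j hj)]
  have hw : ∀ j S₁, (WtOfRecord₁₃H F N θ' p s).w j (s.Λ (j + 1)) ((s.Λ (j + 1))ᶜ ∩ s.Ω (j + 1)) S₁ =
      (WtOfRecord₁₃H F N θ p s).w j (s.Λ (j + 1)) ((s.Λ (j + 1))ᶜ ∩ s.Ω (j + 1)) S₁ := fun j S₁ => rfl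
  have hζ : ∀ ω, (WtOfRecord₁₃H F N θ' p s).ζ k (s.Ω (k + 1))ᶜ ω = v p (k + 1) s.Ω s.Λ (ω (k + 1)).1 := by
    intro ω
    rw [WtOfRecord₁₃H_ζ_eq_ζ0, hζ', if_pos rfl, Set.indicator_of_mem (Set.mem_singleton _), Set.indicator_of_notMem (hYo p (k + 1) s.Ω), add_zero]
  filter_upwards [hJ s] with V hV hχ
  refine slotsT_succ_eq_sect2Slot_of_value θ p s (u p θ.τ9.M) (e p) (WtOfRecord₁₃H F N θ' p s) (v p (k + 1) s.Ω s.Λ) hζlt hw hζ V ?_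
  rw [hvs p k s V]
  by_cases hJ0 : J p k s V = 0
  · have hT : ¬ 0 < T p k s V := fun h => (hV hχ h).ne' hJ0
    show T p k s V / J p k s V * J p k s V = T p k s V
    rw [hJ0, mul_zero]
    exact le_antisymm (hT0 s V) (not_lt.1 hT)
  · exact div_mul_cancel₀ _ hJ0

/-- ★★★★★ **INSIDE K1⁹'s HYPOTHESIS CLASS, `quad` UNTOUCHED**: from any `θ` with K1⁹'s four hypothesis-side conjuncts, the value re-pin `θ′` keeps `ZhUnity`, `SlotsNondegenerate₁₃`,
`Admissible` outright and `Provisos₁₃SepCoPH` under the range inequality `0 ≤ v ≤ 1`, and for every run `p` and EVERY step `k` the support conditions and the term laws give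
`TLaw₁₃CoPH θ′ p k` (`0 ≤ 𝐓ρ_k` from the rows `zetaUnity` ∕ `zetaAbs` of `θ`).  So a pin of `quad` ALONE (C2 without K0b's value pin of `ζ0`) leaves every 𝐓-law conjunct of K1⁹ as free as
before, up to the range inequality.  LOCATED; nothing of Bałaban asserted or refuted; K1⁹'s `∃θ` neither advanced nor refuted. [cite: Balaban1988Convergent, Thm 1 p.262, remark p.262, (2.18) p.257, (2.21)–(2.23) p.258, (3.2)–(3.9) pp.265–266, (3.16)–(3.21) pp.268–269, (3.23)–(3.25) p.270, Def. p.279] -/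
theorem exists_zh_allSteps_tLaw_by_value_of_supports_of_hypotheses (θ : Stage13HParams F N) (hP : θ.Provisos₁₃SepCoPH F N) (hU : θ.ZhUnity)
    (hS' : θ.SlotsNondegenerate₁₃ F N) (hA : θ.Admissible F N)
    (u : (p : B12.RunParams) → (M : ℕ) → Sect2.TermValues (F.P p.K) (MatA N) (FluctV N) M) (e : B12.RunParams → ℝ) :
    ∃ (v : (p : B12.RunParams) → (n : ℕ) → (ℕ → Set (Site (F.P p.K) 0)) → (ℕ → Set (Site (F.P p.K) 0)) → GaugeField (F.P p.K) n (SU N) → ℝ) (θ' : Stage13HParams F N),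
      θ'.toStage13RParams = θ.toStage13RParams ∧ θ'.Phih = θ.Phih ∧
      (∀ p n Ω Λ j Y ω, j + 1 ≠ n → (θ'.Zh p n Ω Λ).ζ0 j Y ω = (θ.Zh p n Ω Λ).ζ0 j Y ω) ∧
      (∀ p n Ω Λ j Λ' ω, (θ'.Zh p n Ω Λ).quad j Λ' ω = (θ.Zh p n Ω Λ).quad j Λ' ω) ∧
      (θ'.ZhUnity ∧ θ'.SlotsNondegenerate₁₃ F N) ∧ θ'.Admissible F N ∧
      ((∀ p n Ω Λ V, 0 ≤ v p n Ω Λ V ∧ v p n Ω Λ V ≤ 1) → θ'.Provisos₁₃SepCoPH F N) ∧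
      (∀ (p : B12.RunParams) (k : ℕ) (s : SeqOfRecord F θ.ν θ.τ9.M (gOfRecord₁₃ F N θ.toStage13Params p) p.K (k + 1)) (V : GaugeField (F.P p.K) (k + 1) (SU N)),
        v p (k + 1) s.Ω s.Λ V =
          slotsTOfRecord F N θ.ν θ.τ9 (EOfRecord₁₃ F N θ.toStage13Params) (wOfRecord₉ F N θ.toStage9Params) θ.ppSel p (gOfRecord₁₃ F N θ.toStage13Params p) (k + 1) s V /
            sect2Slot F N (FluctV N) p.K (settingOfRecord₁₃ F N θ.toStage13Params p) (θ.rzAt p s)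
              { WtOfRecord₁₃H F N θ p s with ζ := fun j Y ω => if j = k then 1 else (WtOfRecord₁₃H F N θ p s).ζ j Y ω } s (u p θ.τ9.M) (e p)
              (UbgOfRecord₁₃CoP F N θ.toStage13Params p (k + 1) s) V) ∧
      ∀ (p : B12.RunParams) (k : ℕ),
        (∀ s : SeqOfRecord F θ.ν θ.τ9.M (gOfRecord₁₃ F N θ.toStage13Params p) p.K (k + 1),
          ∀ᵐ V ∂fieldMeasure (F.P p.K) (k + 1) (SU N), chiSeqOfRecord F N θ.ν θ.τ9.M (gOfRecord₁₃ F N θ.toStage13Params p) p.K (k + 1) s V ≠ 0 →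
            0 < slotsTOfRecord F N θ.ν θ.τ9 (EOfRecord₁₃ F N θ.toStage13Params) (wOfRecord₉ F N θ.toStage9Params) θ.ppSel p (gOfRecord₁₃ F N θ.toStage13Params p) (k + 1) s V →
            0 < sect2Slot F N (FluctV N) p.K (settingOfRecord₁₃ F N θ.toStage13Params p) (θ.rzAt p s)
              { WtOfRecord₁₃H F N θ p s with ζ := fun j Y ω => if j = k then 1 else (WtOfRecord₁₃H F N θ p s).ζ j Y ω } s (u p θ.τ9.M) (e p)
              (UbgOfRecord₁₃CoP F N θ.toStage13Params p (k + 1) s) V) →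
        (∀ s : SeqOfRecord F θ.ν θ.τ9.M (gOfRecord₁₃ F N θ.toStage13Params p) p.K (k + 1),
          Sect2.LawsT (sect2TowerOfRecord F N (FluctV N) p.K (settingOfRecord₁₃ F N θ.toStage13Params p) (θ.rzAt p s) s (u p θ.τ9.M))
            (settingOfRecord₁₃ F N θ.toStage13Params p).lf (settingOfRecord₁₃ F N θ.toStage13Params p).βc k) →
        TLaw₁₃CoPH F N θ' p k := by
  obtain ⟨v, θ', h1, h2, hζoff, hQ, hloc, hun, hlaws, hvs, htl⟩ := exists_zh_allSteps_tLaw_by_value_of_supports θ u e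
  exact ⟨v, θ', h1, h2, hζoff, hQ, ⟨hun hU, slotsNondegenerate₁₃_of_sameR h1 hS'⟩, admissible_of_sameR h1 hA,
    fun hv => provisos₁₃SepCoPH_of_sameR h1 hP (hlaws hv hP.zhLaws) (hloc hP.zhLocal), hvs,
    fun p k hJ hlaw => htl p k (fun s V => slotsTOfRecord_nonneg_of_provisos₁₃CoPH θ p hP.toCore s V) hJ hlaw⟩

end Inhabited


end Summit.QuantumFields.YangMills.Theorems.BalabanUVNodesN11AllStepsZetaValueDial

end
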